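import Summits.RiemannHypothesis.RiemannHypothesis.Theorems.SignConeSignConeOscillatoryStubExtremalExistsValue
import Summits.RiemannHypothesis.RiemannHypothesis.Theorems.SignConeSignConeOscillatoryStubExtremalExistsMultipliers
import Summits.RiemannHypothesis.RiemannHypothesis.Theorems.SignConeSignConeOscillatoryIffInequality
import Summits.RiemannHypothesis.RiemannHypothesis.Theorems.SignConeSignConeOscillatoryUpToThirteenTenths

/-!
# Stub `stub_extremalExists` (line `dual_witness`, crux `SignConeOscillatory`, stmt-RiemannHypothesis-16302), V:
# the KKT-extremal configuration — `SignConeExtremalExists` PROVED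

**Theorem** (`stub_extremalExists : SignConeExtremalExists`, the registered RH-free stub X₁ of line `dual_witness`).
At every cutoff `a > 0` there are `μ, N, c, f` with `IsExtremalKKT a μ N c f`.

Construction.  `m = m(a)` the sign-cone value (part IV); `gₙ` admissible minimising, `gₙ → u` in `L²`,
`supp u ⊆ [-a, a]` (part IV, compactness of the Weil form embedding); `μ := reWar (u ⋆ ũ) + 1 ≤ m` and the
archimedean integrand of `u ⋆ ũ` is integrable (part II, Fatou); `u ⋆ ũ` is node-nonnegative and `Re (u ⋆ ũ)(0) = 1`
(node values pass to `L²`-limits, part I); `N = ⌈e^{2a}⌉`; the multipliers `l ≥ 0` of part III for the slack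
parameter `θ = 1 − m` (its hypothesis `reWar F + (1 − m) Re F(0) ≥ 0` on node-nonnegative family kernels is the
Boas–Kac key inequality of part IV) give the fake primes `c(n) = lₙ √n / 2` on `2 ≤ n < N`.  Then:
(i) `μ Re F(0) ≤ m Re F(0) ≤ reWar F + Re F(0)` on the sign cone; (ii) `u` is the attaining `L²` function;
(iii) `P_c(G) = Σ lₙ Re G(log n) ≤ reWar G + (1 − m) Re G(0) ≤ reWar G + (1 − μ) Re G(0)`; (iv) complementary
slackness: `P_c(gₙ ⋆ g̃ₙ) ≤ reWar (gₙ ⋆ g̃ₙ) + (1 − m) → (m − 1) + (1 − m) = 0` while `P_c(gₙ ⋆ g̃ₙ) → P_c(u ⋆ ũ) ≥ 0`.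
(Incidentally `μ = m`: the `L²` minimum equals the smooth infimum, by (iv).)

With this file the workfile `Cruxes/SignConeOscillatory/Lines/dual_witness.lean` closes MODULO the RH-strength stub
`stub_extremalNonneg` alone (`SignConeOscillatory_of := signConeOscillatory_of_extremal stub_extremalExists …`,
the present theorem having literally the registered type).
-/

noncomputable section

-- `Summit.RiemannHypothesis.RiemannHypothesis.…` repeats a namespace component by design (D-0017 layout).
set_option linter.dupNamespace false

open scoped BigOperators ComplexConjugate Topology
open MeasureTheory Set Filter Complex

namespace Summit.RiemannHypothesis.RiemannHypothesis.Theorems.SignCone.DualWitness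

open Literature.NumberTheory.LFunctions

set_option quotPrecheck false in -- the notation body has binders; it is a closed term over this file's `open`s
/-- X₁ of line `dual_witness`, VERBATIM the body of the workfile's `def SignConeExtremalExists : Prop` (a local notation because
parameterless `def … : Prop` cannot live in Theorems files; see the note in `…DualWitnessDefs.lean`). -/
local notation "SignConeExtremalExists" =>
  ∀ a : ℝ, 0 < a → ∃ μ : ℝ, ∃ N : ℕ, ∃ c : ℕ → ℝ, ∃ f : ℝ → ℂ, IsExtremalKKT a μ N c f

set_option quotPrecheck false in -- as above
/-- X₂ of line `dual_witness`, VERBATIM the body of the workfile's `def SignConeExtremalNonneg : Prop`. -/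
local notation "SignConeExtremalNonneg" =>
  ∀ a μ : ℝ, 0 < a → ∀ (N : ℕ) (c : ℕ → ℝ) (f : ℝ → ℂ), IsExtremalKKT a μ N c f → 0 ≤ μ

/-- The fake primes `c(n) = lₙ √n / 2` on `2 ≤ n < N` reproduce `Σ lₙ Re G(log n)` as `fakePrimeSum c N G`.
[folklore] -/
theorem fakePrimeSum_of_multipliers {N : ℕ} (hN : 2 ≤ N) (l : ℕ → ℝ) (G : ℝ → ℂ) :
    fakePrimeSum (fun n => if n ∈ Finset.Ico 2 N then l n * Real.sqrt n / 2 else 0) N G =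
      ∑ n ∈ Finset.Ico 2 N, l n * (G (Real.log n)).re := by
  unfold fakePrimeSum
  rw [← Finset.Ico_insert_right hN, Finset.sum_insert Finset.right_notMem_Ico]
  simp only [Finset.mem_Ico, lt_self_iff_false, and_false, if_false, zero_div, zero_mul, zero_add]
  refine Finset.sum_congr rfl fun n hn => ?_
  rw [if_pos (Finset.mem_Ico.mp hn)]
  have hn2 : (2 : ℝ) ≤ n := by exact_mod_cast (Finset.mem_Ico.mp hn).1
  have hs : Real.sqrt n ≠ 0 := (Real.sqrt_pos.mpr (by linarith)).ne'
  field_simp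

/-- `2 ≤ ⌈e^{2a}⌉` for `a > 0`. [folklore] -/
theorem two_le_ceil_exp {a : ℝ} (ha : 0 < a) : 2 ≤ ⌈Real.exp (2 * a)⌉₊ := by
  have h : (1 : ℕ) < ⌈Real.exp (2 * a)⌉₊ := Nat.lt_ceil.mpr (by
    have := Real.add_one_lt_exp (by positivity : (2 * a) ≠ 0); push_cast; linarith)
  omega

/-- `Re F(0) ≥ 0` for family kernels. [folklore] -/
theorem coneSum_zero_re_nonneg (k : ℕ) (g : Fin k → ℝ → ℂ) : 0 ≤ (coneSum k g 0).re := by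
  simp only [coneSum, re_sum]
  exact Finset.sum_nonneg fun i _ => by rw [autocorr_zero_re]; exact integral_nonneg fun _ => by positivity

/-- **`SignConeExtremalExists` (stub `stub_extremalExists` of line `dual_witness`, crux `SignConeOscillatory`,
stmt-RiemannHypothesis-16302): KKT-extremal configurations exist at every cutoff.**  See the module docstring for
the construction (sign-cone value, `L²`-limit of a minimising sequence by compactness of the Weil form embedding,
Fatou, Boas–Kac reduction to single tests, shifted cone multipliers, complementary slackness along the sequence).
[folklore] -/
theorem stub_extremalExists : SignConeExtremalExists := by
  intro a ha
  obtain ⟨g, u, hadm, hu, hsu, hlim, hval⟩ := exists_minimising_limit ha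
  set m : ℝ := coneValue a with hm
  have hg' : ∀ n, IsWeilTest (g n) ∧ tsupport (g n) ⊆ Icc (-a) a ∧ ∫ t, ‖g n t‖ ^ 2 = 1 :=
    fun n => ⟨(hadm n).1, (hadm n).2.1, (hadm n).2.2.1⟩
  have hval' : Tendsto (fun n => reWar (autocorr (g n))) atTop (𝓝 (m - 1)) := by
    have h := hval.sub_const 1
    simp only [add_sub_cancel_right] at h
    exact h
  obtain ⟨h0, hint, hle⟩ := lsc_package ha hg' hu hsu hlim hval'
  -- node-nonnegativity of the limit kernel
  have hunodes : ∀ n : ℕ, 2 ≤ n → 0 ≤ (autocorr u (Real.log n)).re := fun n hn =>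
    ge_of_tendsto' ((continuous_re.tendsto _).comp (tendsto_autocorr (memLp_two_of_test hg') hu hlim (Real.log n)))
      fun k => (hadm k).2.2.2 n hn
  -- the multipliers for slack `1 - m`
  obtain ⟨l, hl0, hl⟩ := shifted_multipliers a (1 - m) ha (fun k gf hgf hnodes => by
    have hkey := key_ineq ha (k := k) (g := gf) hgf hnodes
    have e0 : (∑ i, weilConv (gf i) (weilReflect (gf i)) 0).re = (coneSum k gf 0).re := rfl
    have eF : (fun t => ∑ i, weilConv (gf i) (weilReflect (gf i)) t) = coneSum k gf := rfl
    rw [eF, e0, ← reWar_eq]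
    linarith)
  set N : ℕ := ⌈Real.exp (2 * a)⌉₊ with hN
  have hN2 : 2 ≤ N := two_le_ceil_exp ha
  set c : ℕ → ℝ := fun n => if n ∈ Finset.Ico 2 N then l n * Real.sqrt n / 2 else 0 with hc
  have hc0 : ∀ n, 0 ≤ c n := fun n => by
    simp only [hc]
    split_ifs
    · exact div_nonneg (mul_nonneg (hl0 n) (Real.sqrt_nonneg _)) zero_le_two
    · exact le_rfl
  have hfake : ∀ G : ℝ → ℂ, fakePrimeSum c N G = ∑ n ∈ Finset.Ico 2 N, l n * (G (Real.log n)).re :=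
    fun G => fakePrimeSum_of_multipliers hN2 l G
  -- dual feasibility with slack `1 - m` on single tests, in the line's vocabulary
  have hdual : ∀ gt : ℝ → ℂ, IsWeilTest gt → tsupport gt ⊆ Icc (-a) a →
      ∑ n ∈ Finset.Ico 2 N, l n * (autocorr gt (Real.log n)).re ≤ reWar (autocorr gt) + (1 - m) * (autocorr gt 0).re :=
    fun gt hgt hsupp => by
      have h := hl gt hgt hsupp
      rwa [← autocorr_eq_weilConv, ← reWar_eq] at h
  refine ⟨reWar (autocorr u) + 1, N, c, u, Nat.le_ceil _, hc0, ?_, ⟨hu, hsu, h0, hunodes, hint, rfl⟩, ?_, ?_⟩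
  · -- (i) the lower bound on the whole sign cone
    intro k gf hgf hnodes
    have hkey := key_ineq ha hgf hnodes
    have hF0 := coneSum_zero_re_nonneg k gf
    nlinarith
  · -- (iii) dual feasibility with the weaker slack `1 - μ`
    intro gt hgt hsupp
    rw [hfake]
    have h1 := hdual gt ⟨hgt.1, hgt.2⟩ hsupp
    have hG0 : 0 ≤ (autocorr gt 0).re := by rw [autocorr_zero_re]; exact integral_nonneg fun _ => by positivity
    nlinarith
  · -- (iv) complementary slackness along the minimising sequence
    rw [hfake]
    have hlimk : Tendsto (fun k => ∑ n ∈ Finset.Ico 2 N, l n * (autocorr (g k) (Real.log n)).re) atTop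
        (𝓝 (∑ n ∈ Finset.Ico 2 N, l n * (autocorr u (Real.log n)).re)) :=
      tendsto_finsetSum _ fun n _ =>
        ((continuous_re.tendsto _).comp (tendsto_autocorr (memLp_two_of_test hg') hu hlim (Real.log n))).const_mul _
    have hbound : ∀ k, ∑ n ∈ Finset.Ico 2 N, l n * (autocorr (g k) (Real.log n)).re ≤
        reWar (autocorr (g k)) + (1 - m) * 1 := fun k => by
      have h := hdual (g k) (hadm k).1 (hadm k).2.1
      rwa [autocorr_zero_re, (hadm k).2.2.1] at h
    have hlim0 : Tendsto (fun k => reWar (autocorr (g k)) + (1 - m) * 1) atTop (𝓝 ((m - 1) + (1 - m) * 1)) :=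
      hval'.add_const _
    have hle0 := le_of_tendsto_of_tendsto' hlimk hlim0 hbound
    have hge0 : 0 ≤ ∑ n ∈ Finset.Ico 2 N, l n * (autocorr u (Real.log n)).re :=
      Finset.sum_nonneg fun n hn => mul_nonneg (hl0 n) (hunodes n (Finset.mem_Ico.mp hn).1)
    linarith

open Summit.RiemannHypothesis.RiemannHypothesis.Theses.SignCone in
/-- **The crux from X₂ alone.**  With X₁ proved, line `dual_witness` reads: `SignConeExtremalNonneg → SignConeOscillatory`
(the workfile's sorry-free assembly `signConeOscillatory_of_extremal`, verbatim, with `h₁ := stub_extremalExists`):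
take the KKT-extremal configuration at cutoff `a`, read off `0 ≤ μ` from X₂, and combine the lower bound (i) with
`0 ≤ Re F(0)`.  Conditional on the RH-strength X₂, as the line intends. [folklore] -/
theorem signConeOscillatory_of_extremalNonneg (h₂ : SignConeExtremalNonneg) : SignConeOscillatory := by
  intro a ha k g hg F hn _hosc M
  obtain ⟨μ, N, c, f, hK⟩ := stub_extremalExists a ha
  have hμ : 0 ≤ μ := h₂ a μ ha N c f hK
  have hlb : μ * (coneSum k g 0).re ≤ reWar (coneSum k g) + (coneSum k g 0).re := hK.2.2.1 k g hg hn
  have hF0 : 0 ≤ (coneSum k g 0).re := coneSum_zero_re_nonneg k g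
  have hprod : 0 ≤ μ * (coneSum k g 0).re := mul_nonneg hμ hF0
  show -(coneSum k g 0).re ≤ reWar (coneSum k g)
  linarith

open Summit.RiemannHypothesis.RiemannHypothesis.Theses.SignCone
  Summit.RiemannHypothesis.RiemannHypothesis.Theorems.SignCone in
/-- **The crux as a scalar statement: `SignConeOscillatory ↔ ∀ a > 0, 0 ≤ m(a)`**, `m(a) = coneValue a` the sign-cone
value (a genuine infimum, attained in `L²` by `stub_extremalExists`).  `→`: by the landed
`signConeOscillatory_iff_signConeInequality` the crux is the full inequality, which on an admissible (normalised,
node-nonnegative) single test reads `reWar (g ⋆ g̃) + 1 ≥ 0`, so every element of the value set is `≥ 0`.  `←`: the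
Boas–Kac key inequality `m(a) Re F(0) ≤ reWar F + Re F(0)` with `m(a) ≥ 0`. [folklore] -/
theorem signConeOscillatory_iff_coneValue_nonneg : SignConeOscillatory ↔ ∀ a : ℝ, 0 < a → 0 ≤ coneValue a := by
  constructor
  · intro h a ha
    have hI : SignConeInequality := signConeOscillatory_iff_signConeInequality.mp h
    refine le_csInf (valueSet_nonempty ha) ?_
    rintro x ⟨g, hg, rfl⟩
    have e : coneSum 1 (fun _ => g) = autocorr g := by funext t; simp [coneSum]
    have h1 := hI a ha 1 (fun _ => g) (fun _ => ⟨hg.1, hg.2.1⟩) (fun n hn => by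
      show 0 ≤ (coneSum 1 (fun _ => g) (Real.log n)).re
      rw [e]; exact hg.2.2.2 n hn)
    have h2 : -(coneSum 1 (fun _ => g) 0).re ≤ reWar (coneSum 1 (fun _ => g)) := h1
    rw [e] at h2
    have h3 : (autocorr g 0).re = 1 := by rw [autocorr_zero_re, hg.2.2.1]
    linarith
  · intro h
    refine signConeOscillatory_iff_signConeInequality.mpr ?_
    intro a ha k g hg F hn M
    have hkey := key_ineq ha hg hn
    have hF0 : 0 ≤ (coneSum k g 0).re := coneSum_zero_re_nonneg k g
    have hm : 0 ≤ coneValue a := h a ha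
    show -(coneSum k g 0).re ≤ reWar (coneSum k g)
    nlinarith

/-- **The sign-cone value is antitone in the cutoff**: `a ≤ b → m(b) ≤ m(a)` (admissible tests at cutoff `a` are admissible
at `b`). [folklore] -/
theorem coneValue_anti {a b : ℝ} (ha : 0 < a) (hab : a ≤ b) : coneValue b ≤ coneValue a := by
  refine le_csInf (valueSet_nonempty ha) ?_
  rintro x ⟨g, hg, rfl⟩
  exact coneValue_le ⟨hg.1, hg.2.1.trans (Icc_subset_Icc (by linarith) hab), hg.2.2.1, hg.2.2.2⟩

open Summit.RiemannHypothesis.RiemannHypothesis.Theorems.SignCone in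
/-- **Unconditional rung in scalar form: `0 ≤ m(a)` for `0 < a ≤ 13/10`** (from the landed certificate rung
`signConeInequality_upTo_thirteen_tenths`, item body verbatim with `a ≤ 13/10`). [folklore] -/
theorem coneValue_nonneg_of_le_thirteen_tenths {a : ℝ} (ha : 0 < a) (hab : a ≤ 13 / 10) : 0 ≤ coneValue a := by
  refine le_csInf (valueSet_nonempty ha) ?_
  rintro x ⟨g, hg, rfl⟩
  have e : coneSum 1 (fun _ => g) = autocorr g := by funext t; simp [coneSum]
  have h1 := signConeInequality_upTo_thirteen_tenths a ha hab 1 (fun _ => g) (fun _ => ⟨hg.1, hg.2.1⟩) (fun n hn => by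
    show 0 ≤ (coneSum 1 (fun _ => g) (Real.log n)).re
    rw [e]; exact hg.2.2.2 n hn)
  have h2 : -(coneSum 1 (fun _ => g) 0).re ≤ reWar (coneSum 1 (fun _ => g)) := h1
  rw [e] at h2
  have h3 : (autocorr g 0).re = 1 := by rw [autocorr_zero_re, hg.2.2.1]
  linarith

end Summit.RiemannHypothesis.RiemannHypothesis.Theorems.SignCone.DualWitness

end
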